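import Summits.AtomisticToContinuum.Crystallization.Theses.PalmUnimodularRigidity
import Summits.AtomisticToContinuum.Crystallization.Theorems.MinimiserShells.Negative.LoadBearing
import Summits.AtomisticToContinuum.Crystallization.Theorems.MinimiserShells.Negative.Rootedness
import Summits.AtomisticToContinuum.Crystallization.Theorems.PalmUnimodularRigidityMinimiserShellsEquilibriumInLawCountable
import Summits.AtomisticToContinuum.Crystallization.Theorems.PalmUnimodularRigidityMinimiserShellsEquilibriumInLawAssembly
import Literature.Probability.Process.PointStationaryLaw
import Literature.MathematicalPhysics.StatisticalMechanics.RootEnergy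
import Literature.MathematicalPhysics.StatisticalMechanics.MuGSC

/-!
# Stub `stub_equilibriumInLaw` (S1, the lever) of line `equilibrium-in-law-surgery`, crux `MinimiserShells`

Crux item stmt-AtomisticToContinuum-9225, crux decl
`Summit.AtomisticToContinuum.Crystallization.Theses.PalmUnimodularRigidity.MinimiserShells`.

**Theorem.** For every hard core `δ > 0` and every minimising (`E_P[h] ≤ e*`) point-stationary
probability law `P` on rooted `δ`-hard-core configurations of `ℝ³`, `P`-almost every configuration
is the counting measure of a Sütő `μ`-ground-state configuration of Lennard-Jones at chemical
potential `μ = e*` (`IsMuGSC lennardJones eStar S`): no finite modification "remove `n` atoms,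
insert `k` atoms" lowers `U − e*·#`.

**Proof (cluster periodisation, unconditional).**  By `measure_gainEvent_eq_zero` (random-grid
cell averaging via the Mecke identity, the multi-site cluster repair inequality and the
periodisation bound `N e* ≤ U(y)` for finite clusters), each of the countably many gain events
"some `n₀` atoms within `r` of the root can be replaced by the rational configuration `R'` with
gain `≥ 1/(j+1)`" is `P`-null; almost surely none of them happens, and by the countable
reduction `isMuGSC_of_dense` (continuity of Sütő's functional in the inserted positions, rational
points are dense) the configuration is a `μ`GSC at `e*`.  The hypothesis
`UnimodularEnergyLowerBound` (route item 9229) is not used: the periodisation bound for finite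
clusters replaces it.
-/

noncomputable section

open MeasureTheory
open scoped ENNReal BigOperators

namespace Summit.AtomisticToContinuum.Crystallization.Theorems.PalmUnimodularRigidityMinimiserShells.EquilibriumInLaw

open Literature.Probability.Process (IsPointStationaryLaw IsRootedHardCore count_restrict_singleton_ne_zero_iff
  map_sub_count_restrict)
open Literature.MathematicalPhysics.StatisticalMechanics (lennardJones IsMuGSC UniformlyDiscrete)
open Summit.AtomisticToContinuum.Crystallization.Theses.PalmUnimodularRigidity (MinimiserShells UnimodularEnergyLowerBound)
open Summit.AtomisticToContinuum.Crystallization.Theorems.MinimiserShells.Negative.LoadBearing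
  (eStar meanRootEnergy GoodShell minimiserShells_iff)
open Literature.MathematicalPhysics.StatisticalMechanics (interactionEnergy fieldEnergy)
open Summit.AtomisticToContinuum.Crystallization.Theorems.MinimiserShells.Negative.Rootedness (E3)
open Summit.AtomisticToContinuum.Crystallization.Theorems.PalmUnimodularRigidityMinimiserShells.EquilibriumInLaw.Countable
  (isMuGSC_of_dense)
open Summit.AtomisticToContinuum.Crystallization.Theorems.PalmUnimodularRigidityMinimiserShells.EquilibriumInLaw.GainEvent
  (gainCount gainCount_ne_zero_of_gain)
open Summit.AtomisticToContinuum.Crystallization.Theorems.PalmUnimodularRigidityMinimiserShells.EquilibriumInLaw.Assembly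
  (measure_gainEvent_eq_zero)

/-- Rational points of `ℝ³`: the image of `ℚ³` under the coordinate isomorphism. -/
theorem denseRange_ratPt :
    DenseRange fun v : Fin 3 → ℚ => (EuclideanSpace.equiv (Fin 3) ℝ).symm fun c => (v c : ℝ) := by
  have h1 : DenseRange (Pi.map fun _ : Fin 3 => (Rat.cast : ℚ → ℝ)) := DenseRange.piMap fun _ => Rat.denseRange_cast
  have h2 : DenseRange ((EuclideanSpace.equiv (Fin 3) ℝ).symm : (Fin 3 → ℝ) → E3) :=
    (EuclideanSpace.equiv (Fin 3) ℝ).symm.surjective.denseRange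
  exact h2.comp h1 (EuclideanSpace.equiv (Fin 3) ℝ).symm.continuous

/-- **Almost surely no rational gain event happens** (countably many null events). -/
theorem ae_forall_gainCount_eq_zero {δ : ℝ} (hδ : 0 < δ) {P : Measure (Measure E3)} [IsProbabilityMeasure P]
    (hcore : ∀ᵐ μ ∂P, IsRootedHardCore δ μ) (hstat : IsPointStationaryLaw P) (hE : meanRootEnergy P ≤ eStar) :
    ∀ᵐ μ ∂P, ∀ (n₀ k r j : ℕ) (q : Fin k → Fin 3 → ℚ),
      gainCount n₀ k r (1 / ((j : ℝ) + 1)) (fun i => (EuclideanSpace.equiv (Fin 3) ℝ).symm fun c => (q i c : ℝ)) μ = 0 := by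
  refine ae_all_iff.2 fun n₀ => ae_all_iff.2 fun k => ae_all_iff.2 fun r => ae_all_iff.2 fun j =>
    ae_all_iff.2 fun q => ?_
  have h := measure_gainEvent_eq_zero hδ hcore hstat hE n₀ k (r := r) (ε := 1 / ((j : ℝ) + 1))
    (Nat.cast_nonneg r) (by positivity) (fun i => (EuclideanSpace.equiv (Fin 3) ℝ).symm fun c => (q i c : ℝ))
  exact (measure_eq_zero_iff_ae_notMem.1 h).mono fun μ hμ => not_not.1 hμ

/-- **stub_equilibriumInLaw** (S1 of line `equilibrium-in-law-surgery`): minimising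
point-stationary hard-core laws are almost surely carried by Sütő `μ`GSCs of Lennard-Jones at
`μ = e*`.  (The hypothesis `UnimodularEnergyLowerBound` is part of the registered signature but is
not used by this proof.) -/
theorem stub_equilibriumInLaw :
    UnimodularEnergyLowerBound →
      ∀ δ : ℝ, 0 < δ → ∀ P : Measure (Measure (EuclideanSpace ℝ (Fin 3))), IsProbabilityMeasure P →
        (∀ᵐ μ ∂P, IsRootedHardCore δ μ) → IsPointStationaryLaw P → meanRootEnergy P ≤ eStar →
        ∀ᵐ μ ∂P, ∃ S : Set (EuclideanSpace ℝ (Fin 3)),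
          μ = (Measure.count : Measure (EuclideanSpace ℝ (Fin 3))).restrict S ∧ IsMuGSC lennardJones eStar S := by
  intro _ δ hδ P hP hcore hstat hE
  filter_upwards [hcore, ae_forall_gainCount_eq_zero hδ hcore hstat hE] with μ hμ hall
  obtain ⟨S, -, hsep, rfl⟩ := hμ
  refine ⟨S, rfl, ?_⟩
  refine isMuGSC_of_dense (⟨δ, hδ, hsep⟩ : UniformlyDiscrete S) denseRange_ratPt fun n xf hxf hxX k R hRQ hR hdisj => ?_
  -- the inserted configuration has rational coordinates
  choose q hq using hRQ
  obtain rfl : R = fun i => (EuclideanSpace.equiv (Fin 3) ℝ).symm fun c => (q i c : ℝ) :=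
    funext fun i => (hq i).symm
  -- suppose the inequality fails by a margin `> 1/(j+1)` and bound all points by an integer `r`
  by_contra hlt
  rw [not_le] at hlt
  obtain ⟨j, hj⟩ := exists_nat_one_div_lt (sub_pos.2 hlt)
  set r : ℕ := ⌈∑ l, ‖xf l‖ + ∑ i, ‖(EuclideanSpace.equiv (Fin 3) ℝ).symm (fun c => (q i c : ℝ))‖⌉₊ with hr
  have hrsum : ∑ l, ‖xf l‖ + ∑ i, ‖(EuclideanSpace.equiv (Fin 3) ℝ).symm (fun c => (q i c : ℝ))‖ ≤ (r : ℝ) :=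
    Nat.le_ceil _
  have hxr : ∀ l, ‖xf l‖ ≤ (r : ℝ) := fun l => by
    have h1 : ‖xf l‖ ≤ ∑ l, ‖xf l‖ :=
      Finset.single_le_sum (f := fun l => ‖xf l‖) (fun _ _ => norm_nonneg _) (Finset.mem_univ l)
    have h2 : (0 : ℝ) ≤ ∑ i, ‖(EuclideanSpace.equiv (Fin 3) ℝ).symm (fun c => (q i c : ℝ))‖ :=
      Finset.sum_nonneg fun _ _ => norm_nonneg _
    linarith
  have hRr : ∀ i, ‖(EuclideanSpace.equiv (Fin 3) ℝ).symm (fun c => (q i c : ℝ))‖ ≤ (r : ℝ) := fun i => by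
    have h1 : ‖(EuclideanSpace.equiv (Fin 3) ℝ).symm (fun c => (q i c : ℝ))‖ ≤
        ∑ i, ‖(EuclideanSpace.equiv (Fin 3) ℝ).symm (fun c => (q i c : ℝ))‖ :=
      Finset.single_le_sum (f := fun i => ‖(EuclideanSpace.equiv (Fin 3) ℝ).symm (fun c => (q i c : ℝ))‖)
        (fun _ _ => norm_nonneg _) (Finset.mem_univ i)
    have h2 : (0 : ℝ) ≤ ∑ l, ‖xf l‖ := Finset.sum_nonneg fun _ _ => norm_nonneg _
    linarith
  have hgain := gainCount_ne_zero_of_gain (ε := 1 / ((j : ℝ) + 1)) hδ hsep xf hxf hxX hxr hR hRr hdisj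
    (by linarith)
  exact hgain (hall n k r j q)

end Summit.AtomisticToContinuum.Crystallization.Theorems.PalmUnimodularRigidityMinimiserShells.EquilibriumInLaw

end
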